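import Summits.Ventures.PercRepro.SevenThreeSmallPlanesFrame

/-!
# PercRepro — the `(7,3)` cell, (R6) part (f3): the two-line planes (night-3, gen 4)

For a plane `G` with `g = |G| ∈ {5, 6}` points and exactly two three-point lines `ℓ ≠ ℓ′` through a common point
(the conjuncts of the chain's `NightThree.TwoLinesAny`, with `|ℓ ∩ ℓ′| = 1` — on the core the only case): `R₃(G)` is
the set of subsets with `≥ 3` points other than `ℓ, ℓ′` (`R3_eq_of_twoLines`), `λ(B) = [ℓ ⊆ B] + [ℓ′ ⊆ B]`
(`lam3_eq_of_twoLines`), and the cell sum is, by inclusion–exclusion over the two indicators,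
`Σ_b C(g,b)·f(b,0) + 2·C(g−3,b−3)·(f(b,1) − f(b,0)) + C(g−5,b−5)·(f(b,2) − 2f(b,1) + f(b,0))` minus the two lines at
`b = 3` (`sum_R3_twoLines`); the cells `cell_twoFive_t*`, `cell_twoSix_t*` give the per-plane inequality
(`perPlane_twoLines`).  Axioms: standard.
-/

namespace PercRepro

namespace SevenThree

open Finset ThmH SixThree PerFlat

variable {α : Type*} [DecidableEq α] {M : Matroid α} [M.Finite]

/-- The rank-`2` triples of a two-line plane inside `B` are the lines contained in `B`:
`λ(B) = [ℓ ⊆ B] + [ℓ′ ⊆ B]`. -/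
theorem lam3_eq_of_twoLines {G ℓ ℓ' : Finset α} (hℓ3 : ℓ.card = 3) (hℓ'3 : ℓ'.card = 3)
    (hℓr : M.eRk (ℓ : Set α) = 2) (hℓ'r : M.eRk (ℓ' : Set α) = 2) (hne : ℓ ≠ ℓ')
    (hfree : ∀ T ∈ G.powersetCard 3, T ≠ ℓ → T ≠ ℓ' → M.Indep (T : Set α)) {B : Finset α} (hB : B ⊆ G) :
    lam3 M B = (if ℓ ⊆ B then 1 else 0) + (if ℓ' ⊆ B then 1 else 0) := by
  unfold lam3
  have hset : (B.powersetCard 3).filter (fun T : Finset α => M.eRk (T : Set α) = 2) =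
      (if ℓ ⊆ B then {ℓ} else ∅) ∪ (if ℓ' ⊆ B then {ℓ'} else ∅) := by
    ext T
    rw [Finset.mem_filter, Finset.mem_powersetCard, Finset.mem_union]
    constructor
    · rintro ⟨⟨hTB, hT3⟩, hr⟩
      by_cases hTℓ : T = ℓ
      · subst hTℓ; left; rw [if_pos hTB]; exact Finset.mem_singleton_self T
      by_cases hTℓ' : T = ℓ'
      · subst hTℓ'; right; rw [if_pos hTB]; exact Finset.mem_singleton_self T
      exfalso
      have hind := hfree T (Finset.mem_powersetCard.2 ⟨hTB.trans hB, hT3⟩) hTℓ hTℓ'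
      rw [hind.eRk_eq_encard, Set.encard_coe_eq_coe_finsetCard, hT3] at hr
      exact absurd hr (by decide)
    · rintro (hT | hT)
      · by_cases hℓB : ℓ ⊆ B
        · rw [if_pos hℓB, Finset.mem_singleton] at hT; subst hT; exact ⟨⟨hℓB, hℓ3⟩, hℓr⟩
        · rw [if_neg hℓB] at hT; exact absurd hT (Finset.notMem_empty T)
      · by_cases hℓB : ℓ' ⊆ B
        · rw [if_pos hℓB, Finset.mem_singleton] at hT; subst hT; exact ⟨⟨hℓB, hℓ'3⟩, hℓ'r⟩
        · rw [if_neg hℓB] at hT; exact absurd hT (Finset.notMem_empty T)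
  rw [hset]
  by_cases hℓB : ℓ ⊆ B <;> by_cases hℓ'B : ℓ' ⊆ B
  · rw [if_pos hℓB, if_pos hℓ'B, if_pos hℓB, if_pos hℓ'B, Finset.card_union_of_disjoint
      (Finset.disjoint_singleton.2 hne), Finset.card_singleton, Finset.card_singleton]
  · rw [if_pos hℓB, if_neg hℓ'B, if_pos hℓB, if_neg hℓ'B, Finset.union_empty, Finset.card_singleton]
  · rw [if_neg hℓB, if_pos hℓ'B, if_neg hℓB, if_pos hℓ'B, Finset.empty_union, Finset.card_singleton]
  · rw [if_neg hℓB, if_neg hℓ'B, if_neg hℓB, if_neg hℓ'B, Finset.union_empty, Finset.card_empty]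

omit [M.Finite] in
/-- A subset with `≥ 4` points of a two-line plane contains an independent triple (four triples of any `4`-subset,
at most two lines). -/
theorem exists_indep_triple_of_four_twoLines {G ℓ ℓ' B : Finset α}
    (hfree : ∀ T ∈ G.powersetCard 3, T ≠ ℓ → T ≠ ℓ' → M.Indep (T : Set α)) (hB : B ⊆ G) (hB4 : 4 ≤ B.card) :
    ∃ T ⊆ B, T.card = 3 ∧ M.Indep (T : Set α) := by
  obtain ⟨B₄, hB₄B, hB₄4⟩ := Finset.exists_subset_card_eq hB4
  have h4 : (B₄.powersetCard 3).card = 4 := by rw [Finset.card_powersetCard, hB₄4]; decide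
  have hpos : 0 < ((B₄.powersetCard 3) \ {ℓ, ℓ'}).card := by
    have h1 := Finset.le_card_sdiff ({ℓ, ℓ'} : Finset (Finset α)) (B₄.powersetCard 3)
    have h2 : ({ℓ, ℓ'} : Finset (Finset α)).card ≤ 2 := Finset.card_le_two
    omega
  obtain ⟨T, hT⟩ := Finset.card_pos.1 hpos
  rw [Finset.mem_sdiff, Finset.mem_powersetCard, Finset.mem_insert, Finset.mem_singleton] at hT
  push Not at hT
  refine ⟨T, hT.1.1.trans hB₄B, hT.1.2, ?_⟩
  exact hfree T (Finset.mem_powersetCard.2 ⟨(hT.1.1.trans hB₄B).trans hB, hT.1.2⟩) hT.2.1 hT.2.2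

/-- `R₃(G)` of a two-line plane with `≤ 6` points: the subsets with `≥ 3` points other than `ℓ, ℓ′`. -/
theorem R3_eq_of_twoLines {G ℓ ℓ' : Finset α} (hG : G ∈ planes M) (hℓr : M.eRk (ℓ : Set α) = 2)
    (hℓ'r : M.eRk (ℓ' : Set α) = 2)
    (hfree : ∀ T ∈ G.powersetCard 3, T ≠ ℓ → T ≠ ℓ' → M.Indep (T : Set α)) (hg : G.card ≤ 6) :
    R3 M G = (G.powersetCard 3) \ {ℓ, ℓ'} ∪ G.powersetCard 4 ∪ G.powersetCard 5 ∪ G.powersetCard 6 := by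
  have hG3 := (mem_planes.1 hG).2.2
  ext B
  rw [mem_R3_iff, Finset.mem_union, Finset.mem_union, Finset.mem_union, Finset.mem_sdiff, Finset.mem_insert,
    Finset.mem_singleton, Finset.mem_powersetCard, Finset.mem_powersetCard, Finset.mem_powersetCard,
    Finset.mem_powersetCard]
  constructor
  · rintro ⟨hBG, hr⟩
    have h3 := three_le_card_of_eRk_eq_three hr
    have h6 : B.card ≤ 6 := (Finset.card_le_card hBG).trans hg
    rcases (show B.card = 3 ∨ B.card = 4 ∨ B.card = 5 ∨ B.card = 6 by omega) with hc | hc | hc | hc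
    · left; left; left
      refine ⟨⟨hBG, hc⟩, ?_⟩
      rintro (rfl | rfl)
      · rw [hℓr] at hr; exact absurd hr (by decide)
      · rw [hℓ'r] at hr; exact absurd hr (by decide)
    · exact Or.inl (Or.inl (Or.inr ⟨hBG, hc⟩))
    · exact Or.inl (Or.inr ⟨hBG, hc⟩)
    · exact Or.inr ⟨hBG, hc⟩
  · intro hB
    have hBG : B ⊆ G := by
      rcases hB with ((h | h) | h) | h
      · exact h.1.1
      · exact h.1
      · exact h.1
      · exact h.1
    refine ⟨hBG, le_antisymm ?_ ?_⟩
    · rw [← hG3]; exact M.eRk_mono (Finset.coe_subset.2 hBG)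
    · obtain ⟨T, hTB, hT3, hind⟩ : ∃ T ⊆ B, T.card = 3 ∧ M.Indep (T : Set α) := by
        rcases hB with ((h | h) | h) | h
        · push Not at h
          exact ⟨B, Finset.Subset.refl B, h.1.2, hfree B (Finset.mem_powersetCard.2 h.1) h.2.1 h.2.2⟩
        · exact exists_indep_triple_of_four_twoLines hfree hBG (by omega)
        · exact exists_indep_triple_of_four_twoLines hfree hBG (by omega)
        · exact exists_indep_triple_of_four_twoLines hfree hBG (by omega)
      calc (3 : ℕ∞) = M.eRk (T : Set α) := by
            rw [hind.eRk_eq_encard, Set.encard_coe_eq_coe_finsetCard, hT3]; rfl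
        _ ≤ M.eRk (B : Set α) := M.eRk_mono (Finset.coe_subset.2 hTB)

/-- The sum over the `b`-subsets of a two-line plane of a function of `(b, λ)`, by inclusion–exclusion over the
indicators `[ℓ ⊆ B]`, `[ℓ′ ⊆ B]`. -/
theorem sum_powersetCard_twoLines {G ℓ ℓ' : Finset α} (hℓG : ℓ ⊆ G) (hℓ'G : ℓ' ⊆ G) (hℓ3 : ℓ.card = 3)
    (hℓ'3 : ℓ'.card = 3) (hℓr : M.eRk (ℓ : Set α) = 2) (hℓ'r : M.eRk (ℓ' : Set α) = 2) (hne : ℓ ≠ ℓ')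
    (hint : (ℓ ∩ ℓ').card = 1)
    (hfree : ∀ T ∈ G.powersetCard 3, T ≠ ℓ → T ≠ ℓ' → M.Indep (T : Set α)) (f : ℕ → ℕ → ℚ) {b : ℕ} (hb : 5 ≤ b) :
    ∑ B ∈ G.powersetCard b, f B.card (lam3 M B) =
      (G.card.choose b : ℚ) * f b 0 + 2 * ((G \ ℓ).card.choose (b - 3) : ℚ) * (f b 1 - f b 0) +
        ((G \ (ℓ ∪ ℓ')).card.choose (b - 5) : ℚ) * (f b 2 - 2 * f b 1 + f b 0) := by
  have hunion3 : (ℓ ∪ ℓ').card = 5 := by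
    have := Finset.card_union_add_card_inter ℓ ℓ'
    omega
  have h1 : ∀ B ∈ G.powersetCard b, f B.card (lam3 M B) =
      f b 0 + (if ℓ ⊆ B then (1 : ℚ) else 0) * (f b 1 - f b 0) + (if ℓ' ⊆ B then (1 : ℚ) else 0) * (f b 1 - f b 0) +
        (if ℓ ∪ ℓ' ⊆ B then (1 : ℚ) else 0) * (f b 2 - 2 * f b 1 + f b 0) := by
    intro B hB
    rw [Finset.mem_powersetCard] at hB
    rw [lam3_eq_of_twoLines hℓ3 hℓ'3 hℓr hℓ'r hne hfree hB.1, hB.2]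
    by_cases h : ℓ ⊆ B <;> by_cases h' : ℓ' ⊆ B
    · rw [if_pos h, if_pos h', if_pos h, if_pos h', if_pos (Finset.union_subset h h')]; ring
    · rw [if_pos h, if_neg h', if_pos h, if_neg h', if_neg (fun hu => h' (Finset.subset_union_right.trans hu))]; ring
    · rw [if_neg h, if_pos h', if_neg h, if_pos h', if_neg (fun hu => h (Finset.subset_union_left.trans hu))]; ring
    · rw [if_neg h, if_neg h', if_neg h, if_neg h', if_neg (fun hu => h (Finset.subset_union_left.trans hu))]; ring
  rw [Finset.sum_congr rfl h1, Finset.sum_add_distrib, Finset.sum_add_distrib, Finset.sum_add_distrib,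
    Finset.sum_const, Finset.card_powersetCard, nsmul_eq_mul, ← Finset.sum_mul, ← Finset.sum_mul,
    ← Finset.sum_mul, Finset.sum_boole, Finset.sum_boole, Finset.sum_boole]
  have hcℓ := card_filter_subset_powersetCard hℓG (b := b) (by omega)
  have hcℓ' := card_filter_subset_powersetCard hℓ'G (b := b) (by omega)
  have hcu := card_filter_subset_powersetCard (Finset.union_subset hℓG hℓ'G) (b := b) (by omega)
  rw [hℓ3] at hcℓ
  rw [hℓ'3] at hcℓ'
  rw [hunion3] at hcu
  have hGℓ' : (G \ ℓ').card = (G \ ℓ).card := by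
    rw [Finset.card_sdiff, Finset.card_sdiff, Finset.inter_eq_left.2 hℓG, Finset.inter_eq_left.2 hℓ'G, hℓ3, hℓ'3]
  rw [hcℓ, hcℓ', hcu, hGℓ']
  ring

/-- The demand count of a two-line plane at type `t`. -/
theorem card_filter_R3_twoLines {G ℓ ℓ' : Finset α} (hG : G ∈ planes M) (hℓG : ℓ ⊆ G) (hℓ'G : ℓ' ⊆ G)
    (hℓ3 : ℓ.card = 3) (hℓ'3 : ℓ'.card = 3) (hℓr : M.eRk (ℓ : Set α) = 2) (hℓ'r : M.eRk (ℓ' : Set α) = 2)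
    (hne : ℓ ≠ ℓ') (hfree : ∀ T ∈ G.powersetCard 3, T ≠ ℓ → T ≠ ℓ' → M.Indep (T : Set α)) (hg : G.card ≤ 6)
    (t : ℕ) :
    ((R3 M G).filter (fun B => B.card + t ≤ G.card)).card =
      (if 3 + t ≤ G.card then G.card.choose 3 - 2 else 0) + (if 4 + t ≤ G.card then G.card.choose 4 else 0) +
        (if 5 + t ≤ G.card then G.card.choose 5 else 0) + (if 6 + t ≤ G.card then G.card.choose 6 else 0) := by
  have hc : ∀ k : ℕ, ((G.powersetCard k).filter (fun B => B.card + t ≤ G.card)).card =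
      if k + t ≤ G.card then G.card.choose k else 0 := by
    intro k
    by_cases hk : k + t ≤ G.card
    · rw [if_pos hk, ← Finset.card_powersetCard]
      congr 1
      apply Finset.filter_true_of_mem
      intro B hB
      rw [(Finset.mem_powersetCard.1 hB).2]
      exact hk
    · rw [if_neg hk, Finset.card_eq_zero, Finset.filter_eq_empty_iff]
      intro B hB
      rw [(Finset.mem_powersetCard.1 hB).2]
      exact hk
  have hpair : ({ℓ, ℓ'} : Finset (Finset α)) ⊆ G.powersetCard 3 := by
    intro T hT
    rw [Finset.mem_insert, Finset.mem_singleton] at hT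
    rcases hT with rfl | rfl
    · exact Finset.mem_powersetCard.2 ⟨hℓG, hℓ3⟩
    · exact Finset.mem_powersetCard.2 ⟨hℓ'G, hℓ'3⟩
  have hc3 : (((G.powersetCard 3) \ {ℓ, ℓ'}).filter (fun B => B.card + t ≤ G.card)).card =
      if 3 + t ≤ G.card then G.card.choose 3 - 2 else 0 := by
    by_cases hk : 3 + t ≤ G.card
    · rw [if_pos hk, ← Finset.card_powersetCard, ← Finset.card_pair hne,
        ← Finset.card_sdiff_of_subset hpair]
      congr 1
      apply Finset.filter_true_of_mem
      intro B hB
      rw [(Finset.mem_powersetCard.1 (Finset.mem_sdiff.1 hB).1).2]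
      exact hk
    · rw [if_neg hk, Finset.card_eq_zero, Finset.filter_eq_empty_iff]
      intro B hB
      rw [(Finset.mem_powersetCard.1 (Finset.mem_sdiff.1 hB).1).2]
      exact hk
  have hdj : ∀ i j : ℕ, i ≠ j → Disjoint ((G.powersetCard i).filter (fun B => B.card + t ≤ G.card))
      ((G.powersetCard j).filter (fun B => B.card + t ≤ G.card)) :=
    fun i j h => Finset.disjoint_filter_filter (disjoint_powersetCard_of_ne G h)
  have hdj3 : ∀ j : ℕ, 3 ≠ j → Disjoint (((G.powersetCard 3) \ {ℓ, ℓ'}).filter (fun B => B.card + t ≤ G.card))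
      ((G.powersetCard j).filter (fun B => B.card + t ≤ G.card)) :=
    fun j h => Finset.disjoint_filter_filter (Finset.disjoint_of_subset_left Finset.sdiff_subset
      (disjoint_powersetCard_of_ne G h))
  rw [R3_eq_of_twoLines hG hℓr hℓ'r hfree hg, Finset.filter_union, Finset.filter_union, Finset.filter_union,
    Finset.card_union_of_disjoint, Finset.card_union_of_disjoint, Finset.card_union_of_disjoint (hdj3 4 (by decide)),
    hc3, hc 4, hc 5, hc 6]
  · rw [Finset.disjoint_union_left]
    exact ⟨hdj3 5 (by decide), hdj 4 5 (by decide)⟩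
  · rw [Finset.disjoint_union_left, Finset.disjoint_union_left]
    exact ⟨⟨hdj3 6 (by decide), hdj 4 6 (by decide)⟩, hdj 5 6 (by decide)⟩

/-- The cell sum of a two-line plane with `≤ 6` points. -/
theorem sum_R3_twoLines {G ℓ ℓ' : Finset α} (hG : G ∈ planes M) (hℓG : ℓ ⊆ G) (hℓ'G : ℓ' ⊆ G)
    (hℓ3 : ℓ.card = 3) (hℓ'3 : ℓ'.card = 3) (hℓr : M.eRk (ℓ : Set α) = 2) (hℓ'r : M.eRk (ℓ' : Set α) = 2)
    (hne : ℓ ≠ ℓ') (hint : (ℓ ∩ ℓ').card = 1)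
    (hfree : ∀ T ∈ G.powersetCard 3, T ≠ ℓ → T ≠ ℓ' → M.Indep (T : Set α)) (hg : G.card ≤ 6) (f : ℕ → ℕ → ℚ) :
    ∑ B ∈ R3 M G, f B.card (lam3 M B) =
      ((G.card.choose 3 : ℚ) - 2) * f 3 0 +
      ((G.card.choose 4 : ℚ) * f 4 0 + 2 * ((G \ ℓ).card.choose 1 : ℚ) * (f 4 1 - f 4 0)) +
      ((G.card.choose 5 : ℚ) * f 5 0 + 2 * ((G \ ℓ).card.choose 2 : ℚ) * (f 5 1 - f 5 0) +
        ((G \ (ℓ ∪ ℓ')).card.choose 0 : ℚ) * (f 5 2 - 2 * f 5 1 + f 5 0)) +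
      ((G.card.choose 6 : ℚ) * f 6 0 + 2 * ((G \ ℓ).card.choose 3 : ℚ) * (f 6 1 - f 6 0) +
        ((G \ (ℓ ∪ ℓ')).card.choose 1 : ℚ) * (f 6 2 - 2 * f 6 1 + f 6 0)) := by
  have hdj : ∀ i j : ℕ, i ≠ j → Disjoint (G.powersetCard i) (G.powersetCard j) :=
    fun i j h => disjoint_powersetCard_of_ne G h
  have hdj3 : ∀ j : ℕ, 3 ≠ j → Disjoint ((G.powersetCard 3) \ {ℓ, ℓ'}) (G.powersetCard j) :=
    fun j h => Finset.disjoint_of_subset_left Finset.sdiff_subset (disjoint_powersetCard_of_ne G h)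
  rw [R3_eq_of_twoLines hG hℓr hℓ'r hfree hg, Finset.sum_union, Finset.sum_union,
    Finset.sum_union (hdj3 4 (by decide))]
  · -- the triples other than `ℓ, ℓ′`: all `(3, 0)`
    have hpair : ({ℓ, ℓ'} : Finset (Finset α)) ⊆ G.powersetCard 3 := by
      intro T hT
      rw [Finset.mem_insert, Finset.mem_singleton] at hT
      rcases hT with rfl | rfl
      · exact Finset.mem_powersetCard.2 ⟨hℓG, hℓ3⟩
      · exact Finset.mem_powersetCard.2 ⟨hℓ'G, hℓ'3⟩
    have h3 : ∑ B ∈ (G.powersetCard 3) \ {ℓ, ℓ'}, f B.card (lam3 M B) = ((G.card.choose 3 : ℚ) - 2) * f 3 0 := by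
      have : ∀ B ∈ (G.powersetCard 3) \ {ℓ, ℓ'}, f B.card (lam3 M B) = f 3 0 := by
        intro B hB
        rw [Finset.mem_sdiff, Finset.mem_insert, Finset.mem_singleton] at hB
        push Not at hB
        have hB' := Finset.mem_powersetCard.1 hB.1
        rw [lam3_eq_of_twoLines hℓ3 hℓ'3 hℓr hℓ'r hne hfree hB'.1, hB'.2, if_neg, if_neg]
        · intro hℓB
          exact hB.2.2 (Finset.eq_of_subset_of_card_le hℓB (by rw [hB'.2, hℓ'3])).symm
        · intro hℓB
          exact hB.2.1 (Finset.eq_of_subset_of_card_le hℓB (by rw [hB'.2, hℓ3])).symm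
      rw [Finset.sum_congr rfl this, Finset.sum_const, Finset.card_sdiff_of_subset hpair, Finset.card_pair hne,
        Finset.card_powersetCard, nsmul_eq_mul, Nat.cast_sub]
      · push_cast; ring
      · have := Finset.card_le_card hpair
        rw [Finset.card_pair hne, Finset.card_powersetCard] at this
        exact this
    rw [h3, sum_powersetCard_twoLines hℓG hℓ'G hℓ3 hℓ'3 hℓr hℓ'r hne hint hfree f (b := 5) (by norm_num),
      sum_powersetCard_twoLines hℓG hℓ'G hℓ3 hℓ'3 hℓr hℓ'r hne hint hfree f (b := 6) (by norm_num)]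
    -- the `4`-subsets: `[ℓ ∪ ℓ′ ⊆ B]` is impossible (`5 > 4`)
    have h4 : ∑ B ∈ G.powersetCard 4, f B.card (lam3 M B) =
        (G.card.choose 4 : ℚ) * f 4 0 + 2 * ((G \ ℓ).card.choose 1 : ℚ) * (f 4 1 - f 4 0) := by
      have h1 : ∀ B ∈ G.powersetCard 4, f B.card (lam3 M B) =
          f 4 0 + (if ℓ ⊆ B then (1 : ℚ) else 0) * (f 4 1 - f 4 0) +
            (if ℓ' ⊆ B then (1 : ℚ) else 0) * (f 4 1 - f 4 0) := by
        intro B hB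
        rw [Finset.mem_powersetCard] at hB
        rw [lam3_eq_of_twoLines hℓ3 hℓ'3 hℓr hℓ'r hne hfree hB.1, hB.2]
        have hnot : ¬ (ℓ ⊆ B ∧ ℓ' ⊆ B) := by
          rintro ⟨h, h'⟩
          have hu := Finset.card_le_card (Finset.union_subset h h')
          have := Finset.card_union_add_card_inter ℓ ℓ'
          omega
        by_cases h : ℓ ⊆ B <;> by_cases h' : ℓ' ⊆ B
        · exact absurd ⟨h, h'⟩ hnot
        · rw [if_pos h, if_neg h', if_pos h, if_neg h']; ring
        · rw [if_neg h, if_pos h', if_neg h, if_pos h']; ring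
        · rw [if_neg h, if_neg h', if_neg h, if_neg h']; ring
      rw [Finset.sum_congr rfl h1, Finset.sum_add_distrib, Finset.sum_add_distrib, Finset.sum_const,
        Finset.card_powersetCard, nsmul_eq_mul, ← Finset.sum_mul, ← Finset.sum_mul, Finset.sum_boole,
        Finset.sum_boole]
      have hcℓ := card_filter_subset_powersetCard hℓG (b := 4) (by omega)
      have hcℓ' := card_filter_subset_powersetCard hℓ'G (b := 4) (by omega)
      rw [hℓ3] at hcℓ
      rw [hℓ'3] at hcℓ'
      have hGℓ' : (G \ ℓ').card = (G \ ℓ).card := by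
        rw [Finset.card_sdiff, Finset.card_sdiff, Finset.inter_eq_left.2 hℓG, Finset.inter_eq_left.2 hℓ'G, hℓ3, hℓ'3]
      rw [hcℓ, hcℓ', hGℓ']
      ring
    rw [h4]
  · rw [Finset.disjoint_union_left]
    exact ⟨hdj3 5 (by decide), hdj 4 5 (by decide)⟩
  · rw [Finset.disjoint_union_left, Finset.disjoint_union_left]
    exact ⟨⟨hdj3 6 (by decide), hdj 4 6 (by decide)⟩, hdj 5 6 (by decide)⟩

/-- **The two-line planes at `t = 1, 2, 3`** (`|G| ∈ {5, 6}`, the lines through a common point). -/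
theorem perPlane_twoLines (hs : Simple M) (hrank : M.eRank = 7) {G ℓ ℓ' : Finset α} (hG : G ∈ planes M)
    (hℓG : ℓ ⊆ G) (hℓ'G : ℓ' ⊆ G) (hℓ3 : ℓ.card = 3) (hℓ'3 : ℓ'.card = 3) (hℓr : M.eRk (ℓ : Set α) = 2)
    (hℓ'r : M.eRk (ℓ' : Set α) = 2) (hne : ℓ ≠ ℓ') (hint : (ℓ ∩ ℓ').card = 1)
    (hfree : ∀ T ∈ G.powersetCard 3, T ≠ ℓ → T ≠ ℓ' → M.Indep (T : Set α)) (hg5 : 5 ≤ G.card) (hg : G.card ≤ 6)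
    {t : ℕ} (ht1 : 1 ≤ t) (ht3 : t ≤ 3)
    (ht : M.eRk ((gr M \ G : Finset α) : Set α) + (t : ℕ∞) = 7)
    (hno4 : ∀ L ∈ lines M, (L ∩ G).card ≤ 3)
    (hdem : (UqG M 7 3 G).card ≤ ((R3 M G).filter (fun B => B.card + t ≤ G.card)).card) :
    (28 / 5 : ℚ) * ((UqG M 7 3 G).card : ℚ) ≤ ∑ S ∈ Yq M 7 3, fRule M G S / D M S := by
  have hcard := card_filter_R3_twoLines hG hℓG hℓ'G hℓ3 hℓ'3 hℓr hℓ'r hne hfree hg t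
  have hGℓ : (G \ ℓ).card = G.card - 3 := by rw [Finset.card_sdiff, Finset.inter_eq_left.2 hℓG, hℓ3]
  have hGu : (G \ (ℓ ∪ ℓ')).card = G.card - 5 := by
    have hunion5 : (ℓ ∪ ℓ').card = 5 := by
      have := Finset.card_union_add_card_inter ℓ ℓ'
      omega
    rw [Finset.card_sdiff, Finset.inter_eq_left.2 (Finset.union_subset hℓG hℓ'G), hunion5]
  rcases (show t = 1 ∨ t = 2 ∨ t = 3 by omega) with rfl | rfl | rfl
  · apply perPlane_t1_of_cell hs hrank hG ht hno4 hdem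
    rw [sum_R3_twoLines hG hℓG hℓ'G hℓ3 hℓ'3 hℓr hℓ'r hne hint hfree hg Cells.vOne, hcard, hGℓ, hGu]
    rcases (show G.card = 5 ∨ G.card = 6 by omega) with hc | hc <;> rw [hc] <;>
      norm_num [Nat.choose] <;> linarith [Cells.cell_twoFive_t1, Cells.cell_twoSix_t1]
  · apply perPlane_t2_of_cell hs hrank hG ht hno4 hdem
    rw [sum_R3_twoLines hG hℓG hℓ'G hℓ3 hℓ'3 hℓr hℓ'r hne hint hfree hg Cells.vTwo, hcard, hGℓ, hGu]
    rcases (show G.card = 5 ∨ G.card = 6 by omega) with hc | hc <;> rw [hc] <;>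
      norm_num [Nat.choose] <;> linarith [Cells.cell_twoFive_t2, Cells.cell_twoSix_t2]
  · apply perPlane_t3_of_cell hs hrank hG ht hno4 hdem
    rw [sum_R3_twoLines hG hℓG hℓ'G hℓ3 hℓ'3 hℓr hℓ'r hne hint hfree hg Cells.vThree, hcard, hGℓ, hGu]
    rcases (show G.card = 5 ∨ G.card = 6 by omega) with hc | hc <;> rw [hc] <;>
      norm_num [Nat.choose] <;> linarith [Cells.cell_twoFive_t3, Cells.cell_twoSix_t3]

end SevenThree

end PercRepro
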